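import Literature.AlgebraicGeometry.GroupActions.FixedPointScheme
import Literature.AlgebraicGeometry.Hyperkaehler.GeneralizedKummerTypeTranslationGroup
import Literature.AlgebraicGeometry.Hyperkaehler.GeneralizedKummerType
import HarnessLib

/-!
# Fixed points of the translations `A[5]` on the generalized Kummer variety `K⁴(A)` (Oguiso 2020, Prop. 3.5–3.6) — NAMED FACT

Layer `Literature/AlgebraicGeometry/Hyperkaehler`.  CITE record for the cell `hodge-kum4` (ladder
HodgeAV, rung H3; seat p2, memos HOME/p2/I1GEO-ATOMS-r2.md and I1GEO-SPLIT-OPTION.md; the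
Kummer-point input of the cell's residual I1geo, stated in the tree's fixed-point-scheme vocabulary
`GroupActions.IsFixedPointScheme` (Conrad–Gabber–Prasad A.8.10(1), item D1)).  On a generalized
Kummer variety `K = K⁴(A)` of an abelian surface `A` (the Albanese fibre of `A^[5]`, Beauville; file
`GeneralizedKummerType`), every non-trivial element `g` of `Γ(K)` — the automorphisms acting trivially
on `H² ⊕ H³`, i.e. the translations by `A[5]` — has as fixed-point scheme `K^{⟨g⟩}` the disjoint
union of `125 = 5³` reduced `ℂ`-points.

## Sources (read at the page; held arXiv texts)

* K. Oguiso, *No cohomologically trivial nontrivial automorphism of generalized Kummer manifolds*,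
  Nagoya Math. J. 239 (2020) 110–122 [`Oguiso2020CohomologicallyTrivialKummer`, REFEREED],
  Proposition 3.6 (arXiv:1208.3750 p. 6, L10–L49), VERBATIM: "From now on, let `a ∈ T(n) ≃ (ℤ/n)^{⊕4}`
  be an element of order `p ≠ 1` (`p` is not assumed to be prime). Set `d = n/p`. […]
  **Proposition 3.6.** The fixed locus `X^a` consists of `p³` connected components `F_i`
  (`1 ≤ i ≤ p³`), each of which is isomorphic to the generalized Kummer manifold `K_{d−1}(A/⟨a⟩)`
  associated to the 2-dimensional complex torus `A/⟨a⟩`."  Here `X = K_{n−1}(A) ⊂ Hilb^n(A)` (p. 5,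
  L3) and `T(n)` is the group of automorphisms induced by the `n`-torsion translations (p. 3, L25).
  Proof (p. 6, L18–L49): "`a_*𝒮 = 𝒮` if and only if there is a 0-dimensional closed subscheme
  `𝒯 ⊂ A/⟨a⟩` of length `d = n/p` such that `𝒮 = π^*𝒯`. This `𝒯` is unique. Thus we have an
  isomorphism `Hilb^d(A/⟨a⟩) ≃ (Hilb^n(A))^a` by `π^*`", and `X^a` is the union of the fibres of
  `s ∘ ν : Hilb^d(A/⟨a⟩) → A/⟨a⟩` over the `p³` points of `π(A[p])`.  OUR CASE `n = 5`
  (`X = K_4(A) = K⁴(A)`, dimension `8`), `p = 5`, `d = 1`: `K_{d−1} = K_0 =` a point, so `X^a` is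
  `125` points; `Hilb¹(A/⟨a⟩) = A/⟨a⟩` is smooth and the fibre of the étale map `x̄ ↦ 5x̄ + c` over
  a point is reduced, so the `125` points are REDUCED (equivalently: Prop. 3.5 ibid., proof,
  p. 5 L84 – p. 6 L8, "Since `h` is of finite order, `h` is locally linearizable at `P` […] Hence `F`
  is smooth […] the tangent space `T_P F` of `F` is exactly the invariant subspace" — Cartan; the
  finite-group case of Conrad–Gabber–Prasad A.8.10(2)).  Companion Prop. 3.8(2) (p. 6): the Lefschetz
  number `L(a) = n³σ(d) = 125`.
* `Γ(K⁴(A)) = T(5)`: S. Boissière, M. Nieper-Wißkirchen, A. Sarti, *Higher dimensional Enriques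
  varieties and automorphisms of generalized Kummer varieties*, JMPA 95 (2011)
  [`BoissiereNieperWisskirchenSarti2011`, REFEREED], Cor. 3.3(2) (arXiv:1001.4728 p. 7, L81),
  VERBATIM: "The kernel of the map `Aut(K_n(A)) → O(H²(K_n(A), ℤ)), f ↦ f^*` is isomorphic to
  `Tors_n(A) ⋊ ℤ/2ℤ`"; the `ℤ/2` is generated by `ι = −1`, which acts as `−1` on `H³` (Oguiso,
  Lemma 3.4 ibid., p. 5: "`g ∈ K ∖ T(n)` ⟹ `g^*τ = −τ`"), while `T(n)` acts trivially on every `Hᵏ`,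
  `k ≠ 8` (Foster 2024 Rmk. 88, file `GeneralizedKummerTypeTranslationGroup`,
  `Foster2024_translationAction_kum4Type`).  Hence the automorphisms trivial on `H² ⊕ H³`
  (`autFixingH2H3 K`, `ℂ`-coefficients; `H²(K, ℤ)` is torsion-free) are exactly `T(5) ≅ (ℤ/5)⁴`, and
  every `g ∈ Γ(K) ∖ 1` has order `5`.

## Rendering (tree carriers) and faithfulness

For an abelian surface `A` (`A.dim = 2`) and `K` with `IsGeneralizedKummerVarietyOf 4 A K`, smooth
projective of dimension `8` (companion hypothesis, Beauville §7; file `GeneralizedKummerType`), and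
`g ∈ autFixingH2H3 K`, `g ≠ 1`: for every fixed-point scheme `j : F ⟶ K` of the cyclic subgroup
`⟨g⟩ = Subgroup.zpowers g ≤ Aut K` (`GroupActions.IsFixedPointScheme (zpowers g).subtype j`; it
exists, `GroupActions.fixedPointScheme.isFixedPointScheme`, `K` being separated) there are `125`
points `x : Fin 125 → (Spec ℂ ⟶ F)` (sections of the terminal object `𝟙_` of `Over (Spec ℂ)`)
exhibiting `F` as their COPRODUCT (`IsColimit (Cofan.mk F x)`): "`K^{⟨g⟩}` is the disjoint union of
`125` copies of `Spec ℂ`", i.e. `125` reduced points (a coproduct cofan of sections is automatically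
injective; `IsColimit` is `Nonempty`-wrapped since it is data).  `IsGeneralizedKummerVarietyOf` renders
`K ≅ S⁻¹(S(x₀))`, a translate of Beauville's `K_4 = S⁻¹(0)` inside `A^[5]`, isomorphic to it by a
translation of `A` (Beauville §7 footnote 2), so Oguiso's statement applies verbatim.  Stated for
`n = 4` only (the cell's case `d = 1`).
`-- TODO(general form)`: `K_{n−1}(A)`, `a` of order `p | n`, `X^a ≅ p³` copies of `K_{d−1}(A/⟨a⟩)`.

## What is NOT here

No identification of the `125` points with the cosets `x + ⟨u⟩`, `x ∈ A[5]/⟨u⟩` (that needs the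
Hilbert-scheme point model of `K⁴(A)`, the cell's held definition item D3); no statement about the
involution `−1` or the fixed fourfold `W₀`; no claim for deformations of `K⁴(A)`; no proof.
-/

noncomputable section

open CategoryTheory CategoryTheory.Limits MonoidalCategory
open Literature.AlgebraicGeometry.GroupActions

namespace Literature.AlgebraicGeometry.Hyperkaehler

/-- **Oguiso 2020, Prop. 3.6 (with Prop. 3.5; `Γ = A[5]` by Boissière–Nieper-Wißkirchen–Sarti
Cor. 3.3(2)): on `K⁴(A)` every non-trivial `g ∈ Γ` has exactly `125` fixed points, all reduced.**
For `A` an abelian surface, `K` a smooth projective generalized Kummer variety of `A` of dimension `8`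
and `g ∈ autFixingH2H3 K ∖ 1`, every fixed-point scheme `j : F ⟶ K` of `⟨g⟩` is the coproduct of
`125` sections `Spec ℂ ⟶ F` (module docstring for the verbatim statement, the case `n = 5, p = 5,
d = 1`, the rendering and what is not claimed).  A THEOREM in print, unproved in the tree.
[cite: Oguiso2020CohomologicallyTrivialKummer, §3 Prop. 3.6 and Prop. 3.5]
[cite: BoissiereNieperWisskirchenSarti2011, §3 Cor. 3.3(2)] -/
def Oguiso2020_fixedPointScheme_translation_generalizedKummerFour : Prop :=
  ∀ ⦃A : Motives.AbelianVariety ℂ⦄ ⦃K : Motives.SchemeOver ℂ⦄, A.dim = 2 →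
    IsGeneralizedKummerVarietyOf 4 A K → Motives.IsSmoothProjective 8 K →
    ∀ g : autFixingH2H3 K, g ≠ 1 →
      ∀ ⦃F : Motives.SchemeOver ℂ⦄ (j : F ⟶ K),
        IsFixedPointScheme (Subgroup.zpowers g.val).subtype j →
        ∃ x : Fin 125 → (𝟙_ (Motives.SchemeOver ℂ) ⟶ F), Nonempty (IsColimit (Cofan.mk F x))
-- TODO(general form): `K_{n-1}(A)`, `a ∈ T(n)` of order `p`, `X^a ≅ p³ ⊔ K_{d-1}(A/⟨a⟩)`, `d = n/p`.

/-- **Oguiso 2020, Prop. 3.6 (proof, `d = 1`) with Boissière–Nieper-Wißkirchen–Sarti Cor. 3.3(2): on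
`K⁴(A)` the group `Γ = A[5]` acts TRANSITIVELY on the fixed points of each `g ∈ Γ ∖ 1`.**  Oguiso's
proof (arXiv:1208.3750 p. 6, L18–L49) identifies the fixed locus of the translation `a` of order
`p` with the union of the fibres of `s ∘ ν : Hilb^d(A/⟨a⟩) → A/⟨a⟩` over the `p³` points of
`π(A[p])`, the point over `π(c)` being the subscheme `π^*(c̄) = c + ⟨a⟩` for `d = 1`; the translation
by `b ∈ A[n]` (an element of `Γ = T(n)`, BNWS Cor. 3.3(2)) carries `c + ⟨a⟩` to `c + b + ⟨a⟩`, and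
`π(A[5])` is one orbit of `A[5]`: so for `n = p = 5` the `125` fixed points of `g = t_a` form ONE
orbit of `Γ(K)`.  Rendering: for `K` a smooth projective generalized Kummer variety of an abelian
surface (`IsGeneralizedKummerVarietyOf 4 A K`), `g ∈ autFixingH2H3 K ∖ 1`, and two `g`-fixed points
`x, y : Spec ℂ ⟶ K`, some `γ ∈ Γ(K)` carries `x` to `y`.  A one-line consequence of the printed
proof (print-SYNTHESIS, stated for the cell `hodge-kum4`: with the odd-torsor lemma it gives the
uniqueness half of the point count `Summit.Ventures.HodgeKum4.Kum4FixedPointCountAtKummer`); unproved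
in the tree. [cite: Oguiso2020CohomologicallyTrivialKummer, §3 Prop. 3.6 (proof)]
[cite: BoissiereNieperWisskirchenSarti2011, §3 Cor. 3.3(2)] -/
def Oguiso2020_translations_transitive_fixedPoints_generalizedKummerFour : Prop :=
  ∀ ⦃A : Motives.AbelianVariety ℂ⦄ ⦃K : Motives.SchemeOver ℂ⦄, A.dim = 2 →
    IsGeneralizedKummerVarietyOf 4 A K → Motives.IsSmoothProjective 8 K →
    ∀ g : autFixingH2H3 K, g ≠ 1 →
      ∀ x y : 𝟙_ (Motives.SchemeOver ℂ) ⟶ K, x ≫ g.val.hom = x → y ≫ g.val.hom = y →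
        ∃ γ : autFixingH2H3 K, x ≫ γ.val.hom = y
-- TODO(general form): `a ∈ T(n)` of order `p`: `T(n)` permutes the `p³` components of `X^a` transitively.

end Literature.AlgebraicGeometry.Hyperkaehler

end
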